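import Mathlib
import Summits.Ventures.HodgeRepro2.T6N5FockCarrier

/-!
# T6N5FockLiHyp — a SECOND PRINT for the K-types of the joint harmonics at lines: Li 1990 §5 (B), formula (32),
displayed on its own carrier (route/T6-N5-t6-p7.md §14(l)) — Tier 6 (README §10.2), sub-step N5 (t6-p7)

One display, `def … : Prop` in the free parameter `L : LiLineCarrier` (the K̃-type carrier of the line pair in Li's
normalisation: genuine characters of the double cover of `K_V = U(V) = U(1)`, indexed by `w : ℤ` for the weight
`w + ½`; the second sign is Li's signature label of the other line).  The docstring quotes the DEPOSITED JOURNAL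
PRINT (HOME/lit-deposits/Li1990-duke61/Li1990-ThetaLiftingUnitaryRepsNonzeroCohomology-DukeMathJ61.pdf, sha256
9f681df4149bbdfc0ca8f78c71162486c6d823206d6883a2365b02402402bdaf, 25 pp.; renders read by eye
route/t6-p7-renders/Li1990-Duke61/p927-pdf015.png / p928-pdf016.png) — print class, no author copy involved.
The specialisation to lines is the owner's arithmetic (§14(l)), said so in the bracket.  Statement lane:
one structure (data), one definition and `#check` only; count-neutral.  A (C)-form alternative to the KK07
Theorem 5.4(i) display of T6N5FockHyp (whose print, W-11, is pending): NOT a replacement of any accepted file.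
§8(d): uses an L-value-free non-vanishing device: NO.

FILING RECORD (v3, docstring-only): v2 of these bytes ACCEPTED as p442295 (commit f8b5db3b518b, 2026-08-26T11:40Z,
definition lane; read copy route/t6-p7-lean/T6N5FockLiHyp.lean sha256 23c8e36ba2ca4565…), with t6-lit's quote-audit
QA-t6lit-107 FINAL on exactly those bytes (route/T6-LIT-SOURCES.md, RE-CONFIRMATION 11:28:53Z + LANDED 11:45:38Z).
v3 = this paragraph and the `[quote-audit: …]` bracket of `Li1990_eq32_lines` brought up to that record (the v2
bracket still said «PROVISIONAL on the v1 staged bytes»); every declaration byte-identical; count NONE (the PARK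
release clause, STATUS l. 12943, as read by the lead at l. 13037 (1)).
-/

namespace Summit.Ventures.HodgeRepro2.T6.N5Fock

/-- THE K̃-TYPE CARRIER OF THE LINE PAIR IN LI'S NORMALISATION (Li 1990 §5 case (B) with p + q = 1 = m + n):
`occ sV s' w` carries ‹the genuine character of the double cover of `K_V = U(V) = U(1)` of highest weight
`w + ½` occurs in the joint harmonics of the dual pair `(U(V), U(V′))` for Li's Weil representation ω› (the owner's
gloss, not a printed sentence) — `V` of
signature (1,0) for `sV = 1` and (0,1) for `sV = −1`, `V′` of signature (1,0) for `s' = 1` and (0,1) for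
`s' = −1` (Li's labels (p, q) / (m, n) of (32)).  Data only. -/
structure LiLineCarrier where
  /-- ‹the K̃_V-type of highest weight `w + ½` occurs in the joint harmonics› for the lines labelled `sV`, `s'` (gloss) -/
  occ : ℤˣ → ℤˣ → ℤ → Prop

end Summit.Ventures.HodgeRepro2.T6.N5Fock

namespace Summit.Ventures.HodgeRepro2.T6.Hyp

open Summit.Ventures.HodgeRepro2.T6.N5Fock

/-- [cite: Li1990, J.-S. Li, «Theta lifting for unitary representations with nonzero cohomology», Duke Math. J.
61 (1990), no. 3, 913–937, §5 «Infinitesimal characters and joint harmonics», case (B), formula (32), pp. 927–928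
(deposited journal print HOME/lit-deposits/Li1990-duke61/, sha256 9f681df4149bbdfc…, pdf pp. 15–16; renders read
by eye route/t6-p7-renders/Li1990-Duke61/p927-pdf015.png (sha256 6a78d9797e30de1b…) and p928-pdf016.png (sha256
2bbdf4ab919c6c92…); the standing objects p. 926: «Next we turn to the description of correspondence of K-types
occurring in the space of joint harmonics (cf. [14]). This description was known to several people (not including
the author), and can be easily obtained using the known description of duality correspondence in the case when one
member of the dual pair is compact (see [16], [15] and [8]).» … «Below we list the pairs σ, σ′ that correspond to each
other (compare [22], I.4 and [2], §5). More precisely we parameterize the representations σ, σ′ by their highest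
weights and list the pairs of weights that correspond to each other.»; p. 927: «Suppose K̃ = {±1} × K. Since {±1}
will act by its nontrivial character in the Weil representation, we will only consider representations of K̃ which
are nontrivial on {±1}. Below, the highest weight of a representation of K will be used to denote the corresponding
representation of K̃ by the nontrivial extension across {±1}.»)] «(B) (G, G′) = (U(p, q), U(m, n)). We have
K = U(p) × U(q), K′ = U(m) × U(n). The corresponding pairs are» ‹(32) σ = [(μ₁, …, μ_r, 0, …, 0, −ν_s, …, −ν₁)
+ det(·)^{(m−n)/2}] ⊗ [(α₁, …, α_k, 0, …, 0, −β_l, …, −β₁) + det(·)^{−(m−n)/2}], σ′ = [(μ₁, …, μ_r, 0, …, 0,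
−β_l, …, −β₁) + det(·)^{(p−q)/2}] ⊗ [(α₁, …, α_k, 0, …, 0, −ν_s, …, −ν₁) + det(·)^{−(p−q)/2}]› «where
μ₁ ⩾ ⋯ ⩾ μ_r > 0, ν₁ ⩾ ⋯ ⩾ ν_s > 0, α₁ ⩾ ⋯ ⩾ α_k > 0, β₁ ⩾ ⋯ ⩾ β_l > 0. The indices r, s, k, l satisfy the
obvious requirement for the above to be meaningful, namely r + s ⩽ p, k + l ⩽ q, r + l ⩽ m, k + s ⩽ n.»
[display: the case of LINES p + q = 1 = m + n, so `K = U(1)` (the factor `U(0)` trivial), `σ` a single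
half-integral weight; the owner's DERIVATION from (32): (p,q;m,n) = (1,0;1,0) forces k = l = s = 0, r ≤ 1, so
σ = μ₁ + ½ or ½ — the weights {½, 3/2, …}; (1,0;0,1) forces k = l = r = 0, s ≤ 1, so σ = −ν₁ − ½ or −½ — the
weights {−½, −3/2, …}; (0,1;1,0) forces r = s = k = 0, l ≤ 1 — {−½, −3/2, …}; (0,1;0,1) forces r = s = l = 0,
k ≤ 1 — {½, 3/2, …}; in every case σ′ = σ.  `L.occ sV s' w` carries the occurrence of the K̃_V-type of
highest weight `w + ½` for the lines labelled `sV` (V: (1,0) ↦ 1, (0,1) ↦ −1) and `s'` (V′ likewise); the Prop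
states the membership criterion for every (sV, s', w): the half-line `0 ≤ w` when `sV·s' = 1` and `w < 0` when
`sV·s' = −1`.  Li fixes neither the additive character of ω («Let ω be the Weil representation of S̃p», p. 915)
nor which of the two spaces is the skew-hermitian one (p. 913) — the carrier is defined relative to Li's ω and
Li's labels, so this display says exactly what the print says about its own objects; the relation to the KK07
carrier of `T6N5FockCarrier` (the ξ-split normalisation at the character ψ of sign εψ, the skew-hermitian sign
sW) is an EX identification with one universal unit (`T6N5FockLiMain.LiBridge`), never a claim about print;
σ′ (the correspondent) is not carried (not consumed); WEAKER than print (lines only; membership only), marked;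
(32) is a listed description that Li attributes to [16] Kashiwara–Vergne, [15] Howe and [8] Enright–Howe–Wallach
(«This section contains no new results», p. 925), said so here] [residual: PO, PRINT (deposited journal print,
read by eye on the render; README §9(iii) referee re-hash of the deposit applies)] [quote-audit: QA-t6lit-107 FINAL on the
accepted bytes of p442295 (t6-lit register route/T6-LIT-SOURCES.md: RE-CONFIRMATION 2026-08-26T11:28:53Z on the v2 bytes
23c8e36ba2ca4565, 0 nits; LANDED 11:45:38Z on p442295) — first PROVISIONAL on the v1 staged bytes 7cd84b66c310222f (card C69,
STATUS l. 12830); v2 = the three form nits n1–n3 applied; v3 = this bracket + the module's filing record only, docstring-only,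
statements byte-identical] -/
def Li1990_eq32_lines (L : LiLineCarrier) : Prop :=
  ∀ (sV s' : ℤˣ) (w : ℤ), L.occ sV s' w ↔ ((sV * s' = 1 → 0 ≤ w) ∧ (sV * s' = -1 → w < 0))

#check @Li1990_eq32_lines

end Summit.Ventures.HodgeRepro2.T6.Hyp
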